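import Summits.QuantumFields.BalabanUV.Beta.D1BFx.TorusGhostPairStencils

/-!
# TB4-W PART 3b-gh (FILE B3) — the PAIR ghost words of the co-frame jets as periodised `ℤ⁴` arrays (road «BF-x», slot (K))

The torus identities for the MIXED second-order site words of `KGhostTerm` §3 (owner ruling ρ-g7-1 (1), journal l.24670), at the torus images
`b = (σu, κ)`, `b′ = (σu′, l)` of a pair of `ℤ⁴` bonds, on every torus with `|u − u′|₁ + 3 ≤ s` (no wrap-around; along growing tori the hypothesis
holds eventually for every fixed pair, which is what `tendsto_hessT_hessKer` consumes):
* `Ljet₂ (σu,κ) = perT (arr (gh₂ κ u))` (every `s`), `Ljet₁₁ b b′ = [β = β′]·perT (arr (gh₂ κ u))` (`|u − u′|₁ < s`);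
* `Ljet_b · Ljet_b′ = perT (arr (ghCur_β ∘ ghCur_β′))`, `Ljet_b · (Ê_b′ᵀ D̂) = perT (arr (ghCur_β ∘ etD_β′))`, `Ljet₂ L̂`, `L̂ Ljet₂`;
* `Mjet₁₁ b b′ · D̂ = Ljet₁₁ L̂ − (Ljet_b (Ê_b′ᵀ D̂) + Ljet_b′ (Ê_bᵀ D̂)) + [b = b′]·L̂ (Ê_bᵀ D̂)` (matrix algebra, every pair of torus bonds) and
  **`Mjet₁₁ b b′ · D̂ = perT (arr (Xgh₂ κ u l u′))`**;
* **`Ljet₁₁ L̂ + Ljet_b Ljet_b′ + Ljet_b′ Ljet_b + L̂ Ljet₁₁ = perT (arr (Lgh₂ κ u l u′))`**.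

[folklore] assembly of FILES B1∕B2; no new objects.
-/

noncomputable section

namespace Summit.QuantumFields.BalabanUV.Beta.D1BFx.TorusGhostPairArrays

open Matrix
open scoped BigOperators
open Literature.MathematicalPhysics.QuantumFieldTheory.Balaban1983to89
open Literature.MathematicalPhysics.QuantumFieldTheory.Balaban1983to89.Beta
open B12Sec2to5 (l1 l1_nonneg)
open ExpKernelCalculus (MKer BiLoc Decays Zl comp shiftK comp_shiftK biLoc_comp_decays biLoc_comp_biLoc)
open AffineAveraging (unitVec)
open KernelWard (biLoc_add biLoc_sub)
open SecondOrderResponse (biLoc_neg)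
open BalabanStepJetsSucc (biLoc_comp_right)
open StepJetData (l1_add_le)
open Summit.QuantumFields.BalabanUV.Beta.D1BFx.PeriodicArrays (arr toF toF_apply arr_imageShift decays_arr summable_arr_term)
open Summit.QuantumFields.BalabanUV.Beta.D1BFx.FibredPeriodisation (periodiseF periodiseF_apply)
open Summit.QuantumFields.BalabanUV.Beta.D1BFx.GhostStencil (ghCur ghCur_apply biLoc_ghCur ghCur_translate biLoc_ghCnt l1_zero l1_unitVec unitVec_ne_zero)
open Summit.QuantumFields.BalabanUV.Beta.D1BFx.PeriodisedProjector (Lhat)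
open Summit.QuantumFields.BalabanUV.Beta.D1BFx.TorusHodgeWeight (Dhat Dhat_transpose_mul_Dhat)
open Summit.QuantumFields.BalabanUV.Beta.D1BFx.TorusCoframeJets (Djet Ljet Ljet₂ Ljet₁₁ Mjet₁₁ Ljet₁₁_self Ljet₁₁_of_ne)
open Summit.QuantumFields.BalabanUV.Beta.D1BFx.TorusJetArrays (ptPair ptPair_apply biLoc_ptPair Ljet₂_eq_arr)
open Summit.QuantumFields.BalabanUV.Beta.D1BFx.TorusGhostWordArrays (perT perT_apply perT_apply_tsum perT_add perT_sub summable_row_arr arr_add arr_sub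
  perT_arr_mul_perT lapU decays_lapU shiftK_lapU lapU_imageShift etD etD_apply biLoc_hop biLoc_etD etD_translate ptPair_translate shiftK_add shiftK_sub
  Ljet_eq_perT transpose_Djet_mul_Dhat_eq_perT Ljet_mul_Lhat Lhat_mul_Ljet Lhat_mul_transpose_Djet_mul_Dhat)

open Summit.QuantumFields.BalabanUV.Beta.D1BFx.TorusGhostPairStencils (perT_neg perT_zero arr_neg arr_zero biLoc_zero_of_nonneg torus_test_iff
  perT_arr_mul_perT_arr_of_le gh₂ Lgh₂ Xgh₂ biLoc_hop' biLoc_gh₂ ghCur_support etD_support biLoc_swap_pts cC cJ cD cD' biLoc_cur_etD biLoc_cur_cur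
  biLoc_gh₂_lapU biLoc_lapU_gh₂ biLoc_lapU_etD)

variable (s : ℕ) [NeZero s]

/-! ## §4 The torus identities for the pair words -/

section Torus

variable (κ : Fin 4) (u : Fin 4 → ℤ) (l : Fin 4) (u' : Fin 4 → ℤ)

/-- [folklore] **`Ljet₂ = perT (arr gh₂)`** at `b = (σu, κ)`, every `s`. -/
theorem Ljet₂_eq_perT : Ljet₂ s (siteOf 4 s u, κ) = perT s (arr s (gh₂ κ u)) := by
  rw [gh₂, arr_neg, perT_neg, arr_add s (biLoc_hop' κ u 1) one_pos (biLoc_hop κ u 1) one_pos,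
    perT_add s (summable_row_arr s (biLoc_hop' κ u 1) one_pos) (summable_row_arr s (biLoc_hop κ u 1) one_pos), Ljet₂_eq_arr]
  rfl

/-- [folklore] **`Ljet₁₁ b b′ = [β = β′]·perT (arr gh₂)`** for `|u − u′|₁ < s` (the torus test is the `ℤ⁴` test). -/
theorem Ljet₁₁_eq_perT (hs : l1 (u - u') < s) :
    Ljet₁₁ s (siteOf 4 s u, κ) (siteOf 4 s u', l) = if u = u' ∧ κ = l then perT s (arr s (gh₂ κ u)) else 0 := by
  by_cases h : u = u' ∧ κ = l
  · rw [if_pos h, ← h.1, ← h.2, Ljet₁₁_self, Ljet₂_eq_perT]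
  · rw [if_neg h, Ljet₁₁_of_ne]
    exact fun hb => h ((torus_test_iff s κ l hs).mp hb)

variable {u u'}

omit [NeZero s] in
/-- [folklore] `|u′ − u|₁ + 3 ≤ s` from `|u − u′|₁ + 3 ≤ s`. -/
theorem hs_symm (hs : l1 (u - u') + 3 ≤ s) : l1 (u' - u) + 3 ≤ s := by rwa [Beta.l1_sub_comm u' u]

omit [NeZero s] in
/-- [folklore] `|u − u′|₁ < s` from `|u − u′|₁ + 3 ≤ s`. -/
theorem hs_lt (hs : l1 (u - u') + 3 ≤ s) : l1 (u - u') < s := by linarith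

variable (u u')

/-- [folklore] **`Ljet_b · Ljet_b′ = perT (arr (ghCur_β ∘ ghCur_β′))`** for `|u − u′|₁ + 3 ≤ s`. -/
theorem Ljet_mul_Ljet (hs : l1 (u - u') + 3 ≤ s) :
    Ljet s (siteOf 4 s u, κ) * Ljet s (siteOf 4 s u', l) = perT s (arr s (comp (ghCur κ u) (ghCur l u'))) := by
  rw [Ljet_eq_perT, Ljet_eq_perT,
    perT_arr_mul_perT_arr_of_le s (biLoc_ghCur κ u 1) one_pos (biLoc_ghCur l u' 1) one_pos (ghCur_support κ u) (ghCur_support l u') hs]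

/-- [folklore] **`Ljet_b · (Ê_b′ᵀ D̂) = perT (arr (ghCur_β ∘ etD_β′))`** for `|u − u′|₁ + 3 ≤ s`. -/
theorem Ljet_mul_etD (hs : l1 (u - u') + 3 ≤ s) :
    Ljet s (siteOf 4 s u, κ) * ((Djet s (siteOf 4 s u', l))ᵀ * Dhat 4 s) = perT s (arr s (comp (ghCur κ u) (etD l u'))) := by
  rw [Ljet_eq_perT, transpose_Djet_mul_Dhat_eq_perT,
    perT_arr_mul_perT_arr_of_le s (biLoc_ghCur κ u 1) one_pos (biLoc_etD l u' 1) one_pos (ghCur_support κ u) (etD_support l u') hs]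

/-- [folklore] `Ljet₂ · L̂ = perT (arr (gh₂ ∘ lapU))`, every `s`. -/
theorem Ljet₂_mul_Lhat : Ljet₂ s (siteOf 4 s u, κ) * Lhat s = perT s (arr s (comp (gh₂ κ u) lapU)) := by
  rw [Ljet₂_eq_perT, TorusGhostWordArrays.Lhat_eq_perT,
    perT_arr_mul_perT s decays_lapU one_pos (lapU_imageShift s) (biLoc_gh₂ κ u 1) one_pos]

/-- [folklore] `L̂ · Ljet₂ = perT (arr (lapU ∘ gh₂))`, every `s`. -/
theorem Lhat_mul_Ljet₂ : Lhat s * Ljet₂ s (siteOf 4 s u, κ) = perT s (arr s (comp lapU (gh₂ κ u))) := by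
  rw [Ljet₂_eq_perT, TorusGhostWordArrays.Lhat_eq_perT,
    TorusGhostWordArrays.perT_mul_perT_arr s decays_lapU one_pos (lapU_imageShift s) (biLoc_gh₂ κ u 1) one_pos]

/-- [folklore] **THE GHOST PAIR WORD, MATRIX FORM** (every pair of torus bonds):
`Mjet₁₁ b b′ · D̂ = Ljet₁₁ L̂ − (Ljet_b (Ê_b′ᵀ D̂) + Ljet_b′ (Ê_bᵀ D̂)) + [b = b′]·L̂ (Ê_bᵀ D̂)`. -/
theorem Mjet₁₁_mul_Dhat (b b' : Site 4 s × Fin 4) : Mjet₁₁ s b b' * Dhat 4 s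
    = Ljet₁₁ s b b' * Lhat s - (Ljet s b * ((Djet s b')ᵀ * Dhat 4 s) + Ljet s b' * ((Djet s b)ᵀ * Dhat 4 s))
      + (if b = b' then Lhat s * ((Djet s b)ᵀ * Dhat 4 s) else 0) := by
  rw [Mjet₁₁, Matrix.add_mul, Matrix.sub_mul, Matrix.add_mul, Matrix.mul_assoc, Dhat_transpose_mul_Dhat, Matrix.mul_assoc,
    Matrix.mul_assoc]
  congr 1
  split_ifs
  · rw [Matrix.mul_assoc]
  · rw [Matrix.zero_mul]

/-- [folklore] **THE GHOST PAIR WORD AS ONE ARRAY**: `Mjet₁₁ (σu,κ) (σu′,l) · D̂ = perT (arr (Xgh₂ κ u l u′))` for `|u − u′|₁ + 3 ≤ s` (owner ρ-g7-1 (1):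
the slot `𝒳₂ β β′`; on the growing tori the hypothesis holds eventually for every fixed pair). -/
theorem Mjet₁₁_mul_Dhat_eq_perT (hs : l1 (u - u') + 3 ≤ s) :
    Mjet₁₁ s (siteOf 4 s u, κ) (siteOf 4 s u', l) * Dhat 4 s = perT s (arr s (Xgh₂ κ u l u')) := by
  rw [Mjet₁₁_mul_Dhat, Ljet_mul_etD s κ u l u' hs, Ljet_mul_etD s l u' κ u (hs_symm s hs), Xgh₂,
    arr_sub s ?biLocD (by norm_num : (0 : ℝ) < 1 / 2) (biLoc_add (biLoc_cur_etD κ u l u') (biLoc_swap_pts (biLoc_cur_etD l u' κ u) (by norm_num : (0 : ℝ) ≤ 1 / 2))) (by norm_num : (0 : ℝ) < 1 / 2),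
    perT_sub s (summable_row_arr s ?biLocD (by norm_num : (0 : ℝ) < 1 / 2))
      (summable_row_arr s (biLoc_add (biLoc_cur_etD κ u l u') (biLoc_swap_pts (biLoc_cur_etD l u' κ u) (by norm_num : (0 : ℝ) ≤ 1 / 2))) (by norm_num : (0 : ℝ) < 1 / 2)),
    arr_add s (biLoc_cur_etD κ u l u') (by norm_num : (0 : ℝ) < 1 / 2) (biLoc_cur_etD l u' κ u) (by norm_num : (0 : ℝ) < 1 / 2),
    perT_add s (summable_row_arr s (biLoc_cur_etD κ u l u') (by norm_num : (0 : ℝ) < 1 / 2))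
      (summable_row_arr s (biLoc_cur_etD l u' κ u) (by norm_num : (0 : ℝ) < 1 / 2))]
  case biLocD =>
    exact (show BiLoc (if u = u' ∧ κ = l then comp (gh₂ κ u) lapU + comp lapU (etD κ u) else 0) u u (cD) (1 / 2) from by
      by_cases h : u = u' ∧ κ = l
      · rw [if_pos h]; exact biLoc_add (biLoc_gh₂_lapU κ u) (biLoc_lapU_etD κ u)
      · rw [if_neg h]
        refine biLoc_zero_of_nonneg u u ?_ _
        have hZ : 0 ≤ Zl 4 (1 - 1 / 2) := (ExpKernelCalculus.Zl_pos (by norm_num)).le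
        unfold cD; positivity)
  by_cases h : u = u' ∧ κ = l
  · obtain ⟨rfl, rfl⟩ := h
    rw [if_pos (rfl : (siteOf 4 s u, κ) = (siteOf 4 s u, κ)), if_pos (And.intro rfl rfl : u = u ∧ κ = κ), Ljet₁₁_self, Ljet₂_mul_Lhat,
      Lhat_mul_transpose_Djet_mul_Dhat,
      arr_add s (biLoc_gh₂_lapU κ u) (by norm_num : (0 : ℝ) < 1 / 2) (biLoc_lapU_etD κ u) (by norm_num : (0 : ℝ) < 1 / 2),
      perT_add s (summable_row_arr s (biLoc_gh₂_lapU κ u) (by norm_num : (0 : ℝ) < 1 / 2))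
        (summable_row_arr s (biLoc_lapU_etD κ u) (by norm_num : (0 : ℝ) < 1 / 2))]
    abel
  · rw [if_neg h, if_neg (fun hb => h ((torus_test_iff s κ l (hs_lt s hs)).mp hb)), Ljet₁₁_of_ne s _ _ (fun hb => h ((torus_test_iff s κ l (hs_lt s hs)).mp hb)),
      Matrix.zero_mul, arr_zero, perT_zero]
    abel

/-- [folklore] **THE `L̂²` PAIR WORD AS ONE ARRAY**: `Ljet₁₁ L̂ + Ljet_b Ljet_b′ + Ljet_b′ Ljet_b + L̂ Ljet₁₁ = perT (arr (Lgh₂ κ u l u′))` for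
`|u − u′|₁ + 3 ≤ s` (the slot `ℒ₂ β β′`). -/
theorem Lsq_pair_word_eq_perT (hs : l1 (u - u') + 3 ≤ s) :
    Ljet₁₁ s (siteOf 4 s u, κ) (siteOf 4 s u', l) * Lhat s + Ljet s (siteOf 4 s u, κ) * Ljet s (siteOf 4 s u', l)
        + Ljet s (siteOf 4 s u', l) * Ljet s (siteOf 4 s u, κ) + Lhat s * Ljet₁₁ s (siteOf 4 s u, κ) (siteOf 4 s u', l)
      = perT s (arr s (Lgh₂ κ u l u')) := by
  rw [Ljet_mul_Ljet s κ u l u' hs, Ljet_mul_Ljet s l u' κ u (hs_symm s hs), Lgh₂,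
    arr_add s ?biLocD (by norm_num : (0 : ℝ) < 1 / 2) (biLoc_add (biLoc_cur_cur κ u l u') (biLoc_swap_pts (biLoc_cur_cur l u' κ u) (by norm_num : (0 : ℝ) ≤ 1 / 2))) (by norm_num : (0 : ℝ) < 1 / 2),
    perT_add s (summable_row_arr s ?biLocD (by norm_num : (0 : ℝ) < 1 / 2))
      (summable_row_arr s (biLoc_add (biLoc_cur_cur κ u l u') (biLoc_swap_pts (biLoc_cur_cur l u' κ u) (by norm_num : (0 : ℝ) ≤ 1 / 2))) (by norm_num : (0 : ℝ) < 1 / 2)),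
    arr_add s (biLoc_cur_cur κ u l u') (by norm_num : (0 : ℝ) < 1 / 2) (biLoc_cur_cur l u' κ u) (by norm_num : (0 : ℝ) < 1 / 2),
    perT_add s (summable_row_arr s (biLoc_cur_cur κ u l u') (by norm_num : (0 : ℝ) < 1 / 2))
      (summable_row_arr s (biLoc_cur_cur l u' κ u) (by norm_num : (0 : ℝ) < 1 / 2))]
  case biLocD =>
    exact (show BiLoc (if u = u' ∧ κ = l then comp (gh₂ κ u) lapU + comp lapU (gh₂ κ u) else 0) u u (cD') (1 / 2) from by
      by_cases h : u = u' ∧ κ = l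
      · rw [if_pos h]; exact biLoc_add (biLoc_gh₂_lapU κ u) (biLoc_lapU_gh₂ κ u)
      · rw [if_neg h]
        refine biLoc_zero_of_nonneg u u ?_ _
        have hZ : 0 ≤ Zl 4 (1 - 1 / 2) := (ExpKernelCalculus.Zl_pos (by norm_num)).le
        unfold cD'; positivity)
  by_cases h : u = u' ∧ κ = l
  · obtain ⟨rfl, rfl⟩ := h
    rw [if_pos (And.intro rfl rfl : u = u ∧ κ = κ), Ljet₁₁_self, Ljet₂_mul_Lhat, Lhat_mul_Ljet₂,
      arr_add s (biLoc_gh₂_lapU κ u) (by norm_num : (0 : ℝ) < 1 / 2) (biLoc_lapU_gh₂ κ u) (by norm_num : (0 : ℝ) < 1 / 2),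
      perT_add s (summable_row_arr s (biLoc_gh₂_lapU κ u) (by norm_num : (0 : ℝ) < 1 / 2))
        (summable_row_arr s (biLoc_lapU_gh₂ κ u) (by norm_num : (0 : ℝ) < 1 / 2))]
    abel
  · rw [if_neg h, Ljet₁₁_of_ne s _ _ (fun hb => h ((torus_test_iff s κ l (hs_lt s hs)).mp hb)), Matrix.zero_mul, Matrix.mul_zero, arr_zero,
      perT_zero]
    abel

end Torus

end Summit.QuantumFields.BalabanUV.Beta.D1BFx.TorusGhostPairArrays

end
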